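import Summits.SmoothPoincare4.SmoothPoincare4.Theorems.SblfDescentRungOneHelperBottHessianA
import Literature.Topology.FourManifolds.MorseChartChange
import Literature.Topology.FourManifolds.CircleNormalFraming
import Mathlib.Geometry.Manifold.MFDeriv.Tangent
import Mathlib.Analysis.Calculus.FDeriv.Symmetric
import HarnessLib

/-!
# The fibre Hessian of the height family along a Morse–Bott maximum circle (tube layer, part B)

Auxiliary file of helper `helper_bott_tube` of stub `helper_sliceGluing_bottRecognition` (fibred
Morse–Bott recognition of the polar tube), line `Sketch`, crux `SblfDescent.RungOne`.

(Crux item stmt-SmoothPoincare4-18531; skeleton `Cruxes/RungOne/Lines/Sketch.lean`.)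

In the setting `BottTube.TSetup` of part A (a circle `e(𝕊¹)` of critical points of `F` at the
level `b` which is a **Bott-nondegenerate maximum** — `Hess F ≤ 0` along the circle with null
vectors only the tangent vectors of the circle — a tube `ν₀` and an equivariant tube
reparametrisation `Φ₁`), the height family `g (t, y) = b - F (ν₀ (circlePt × id) (Φ₁ (t, κ y)))`
has **positive definite fibre Hessian along the zero section**:
`∂ᵧ∂ᵧ g (t, 0) (a, a) > 0` for `a ≠ 0` (`BottTube.TSetup.fibreHessian_pos`).  Indeed, read in the
chart `φ` at `x₀ = e (circlePt t)`, `g = b - (F ∘ φ⁻¹) ∘ (φ ∘ Θ₀)` near `(t, 0)` with `x₀`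
critical, so by the second-order chain rule at a critical point
(`Literature.Topology.FourManifolds.fderiv_fderiv_comp_apply_of_fderiv_eq_zero`, Milnor 1963,
§2) `∂∂ g (t, 0) (v, v) = -Hess F (x₀) (w, w)`, `w = d(φ ∘ Θ₀)(t, 0) v`; for a fibre vector
`v = (0, a)` with `a ≠ 0` the vector `w` is not tangent to the circle (the horizontal vectors
`d(φ ∘ Θ₀)(c, 0)` exhaust the tangent line, and `d(φ ∘ Θ₀)(t, 0)` is injective, part A).
Together with smoothness, periodicity, criticality of the zero section (part A) and symmetry of
second derivatives this is the input of the fibrewise Morse lemma with a Gram–Schmidt frame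
(`BottTube.TSetup.heightFamily_spec`).

## References

* A. Banyaga, D. E. Hurtubise, *A proof of the Morse–Bott Lemma*, Expo. Math. 22 (2004), Thm. 2.
  [BanyagaHurtubise2004]
* J. Milnor, *Morse theory* (1963), §2. [Milnor1963]
-/

set_option linter.dupNamespace false

noncomputable section

open scoped Manifold ContDiff Topology
open Set Function Filter Metric Literature.Topology.FourManifolds

namespace Summit.SmoothPoincare4.SmoothPoincare4.Cruxes.RungOne.Sketch

namespace BottTube

namespace TSetup

variable {X : Type} [TopologicalSpace X] [ChartedSpace (EuclideanSpace ℝ (Fin 4)) X]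
  [IsManifold (𝓡 4) ∞ X] (D : TSetup X)

/-- The lifted tube read in the chart at `e (circlePt t)`. [folklore] -/
def τ (t : ℝ) (q : ℝ × EuclideanSpace ℝ (Fin 3)) : EuclideanSpace ℝ (Fin 4) :=
  extChartAt (𝓡 4) (D.e (circlePt t)) (D.Θ₀ q)

/-- `τ t (t, 0) = φ x₀`. [folklore] -/
theorem τ_self (t : ℝ) : D.τ t (t, 0) = extChartAt (𝓡 4) (D.e (circlePt t)) (D.e (circlePt t)) := by
  rw [τ, D.Θ₀_zero]

/-- `τ t` is smooth at `(t, 0)`. [folklore] -/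
theorem contMDiffAt_τ (t : ℝ) :
    ContMDiffAt 𝓘(ℝ, ℝ × EuclideanSpace ℝ (Fin 3)) 𝓘(ℝ, EuclideanSpace ℝ (Fin 4)) ∞ (D.τ t) (t, 0) := by
  have h1 : ContMDiffAt (𝓡 4) 𝓘(ℝ, EuclideanSpace ℝ (Fin 4)) ∞ (extChartAt (𝓡 4) (D.e (circlePt t)))
      (D.Θ₀ (t, 0)) := by
    rw [D.Θ₀_zero]; exact contMDiffAt_extChartAt
  exact h1.comp (t, 0) (D.contMDiffAt_Θ₀ t)

/-- **The horizontal derivative of `τ t` at `(t, 0)` is the velocity of the circle**: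
`dτ (c, 0) = de (d circlePt c)`. [folklore] -/
theorem fderiv_τ_horizontal (t c : ℝ) :
    fderiv ℝ (D.τ t) (t, 0) (c, 0) =
      mfderiv (𝓡 1) (𝓡 4) D.e (circlePt t) (mfderiv 𝓘(ℝ, ℝ) (𝓡 1) circlePt t c) := by
  have hn : (∞ : WithTop ℕ∞) ≠ 0 := by simp
  set x₀ := D.e (circlePt t) with hx₀
  set φ := extChartAt (𝓡 4) x₀ with hφ
  -- along the zero section `τ (s, 0) = φ (e (circlePt s))`
  set γ : ℝ → EuclideanSpace ℝ (Fin 4) := (D.τ t) ∘ fun s : ℝ => ((s, 0) : ℝ × EuclideanSpace ℝ (Fin 3)) with hγ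
  have hcurve : γ = (φ ∘ D.e) ∘ circlePt := by
    funext s
    show extChartAt (𝓡 4) (D.e (circlePt t)) (D.Θ₀ (s, 0)) = φ (D.e (circlePt s))
    rw [D.Θ₀_zero]
  -- the partial derivative along `(c, 0)` is the derivative of the restriction
  have hτd : DifferentiableAt ℝ (D.τ t) (t, 0) :=
    ((contMDiffAt_iff_contDiffAt.1 (D.contMDiffAt_τ t)).differentiableAt (by simp))
  have h1 : HasFDerivAt γ ((fderiv ℝ (D.τ t) (t, 0)).comp ((ContinuousLinearMap.id ℝ ℝ).prod
        (0 : ℝ →L[ℝ] EuclideanSpace ℝ (Fin 3)))) t := by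
    refine HasFDerivAt.comp t hτd.hasFDerivAt ?_
    exact (hasFDerivAt_id t).prodMk (hasFDerivAt_const (0 : EuclideanSpace ℝ (Fin 3)) t)
  have h2 : fderiv ℝ γ t c = fderiv ℝ (D.τ t) (t, 0) (c, 0) := by
    rw [h1.fderiv]; simp
  rw [← h2, ← mfderiv_eq_fderiv, hcurve]
  -- chain rule for `(φ ∘ e) ∘ circlePt`
  have he : MDifferentiableAt (𝓡 1) (𝓡 4) D.e (circlePt t) := (D.contMDiff_e _).mdifferentiableAt hn
  have hφ' : MDifferentiableAt (𝓡 4) (𝓡 4) φ x₀ :=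
    (contMDiffAt_extChartAt (n := ∞)).mdifferentiableAt hn
  have hφe : MDifferentiableAt (𝓡 1) 𝓘(ℝ, EuclideanSpace ℝ (Fin 4)) (φ ∘ D.e) (circlePt t) :=
    hφ'.comp (circlePt t) he
  have hc : MDifferentiableAt 𝓘(ℝ, ℝ) (𝓡 1) circlePt t := contMDiff_circlePt.contMDiffAt.mdifferentiableAt hn
  have e1 : mfderiv 𝓘(ℝ, ℝ) 𝓘(ℝ, EuclideanSpace ℝ (Fin 4)) ((φ ∘ D.e) ∘ circlePt) t =
      ((mfderiv (𝓡 4) (𝓡 4) φ x₀).comp (mfderiv (𝓡 1) (𝓡 4) D.e (circlePt t))).comp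
        (mfderiv 𝓘(ℝ, ℝ) (𝓡 1) circlePt t) := by
    rw [mfderiv_comp t hφe hc, mfderiv_comp (circlePt t) hφ' he]
    rfl
  rw [e1]
  -- `dφ (x₀) = id`
  have hmf : mfderiv (𝓡 4) (𝓡 4) φ x₀ = tangentCoordChange (𝓡 4) x₀ x₀ x₀ :=
    mfderiv_chartAt_eq_tangentCoordChange (mem_chart_source _ x₀)
  have hid : ∀ v : TangentSpace (𝓡 4) x₀, mfderiv (𝓡 4) (𝓡 4) φ x₀ v = v := fun v => by
    rw [hmf]
    have h := tangentCoordChange_self (I := 𝓡 4) (x := x₀) (z := x₀) (v := (v : EuclideanSpace ℝ (Fin 4)))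
      (mem_extChartAt_source x₀)
    exact h
  exact hid _

/-- **Fibre vectors are not tangent to the circle**: if `dτ (0, a)` lies in the image of `de`,
then `a = 0`. [folklore] -/
theorem eq_zero_of_mem_range {t : ℝ} {a : EuclideanSpace ℝ (Fin 3)}
    (h : fderiv ℝ (D.τ t) (t, 0) ((0 : ℝ), a) ∈ range (mfderiv (𝓡 1) (𝓡 4) D.e (circlePt t))) : a = 0 := by
  obtain ⟨ξ, hξ⟩ := h
  obtain ⟨c', rfl⟩ := CircleSetup.surjective_mfderiv_circlePt t ξ
  set c : ℝ := c' with hc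
  rw [← D.fderiv_τ_horizontal t c] at hξ
  have h0 : fderiv ℝ (D.τ t) (t, 0) ((-c : ℝ), a) = 0 := by
    have : (((-c : ℝ), a) : ℝ × EuclideanSpace ℝ (Fin 3)) =
        (((0 : ℝ), a) : ℝ × EuclideanSpace ℝ (Fin 3)) - (((c : ℝ), (0 : EuclideanSpace ℝ (Fin 3))) : ℝ × EuclideanSpace ℝ (Fin 3)) :=
      Prod.ext (by simp) (by simp)
    rw [this, map_sub, hξ, sub_self]
  have hinj := D.injective_fderiv_chart_Θ₀ t
  have h1 : (((-c : ℝ), a) : ℝ × EuclideanSpace ℝ (Fin 3)) = 0 := hinj (h0.trans (map_zero _).symm)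
  exact (Prod.mk.inj h1).2

/-- **The Hessian of the height family at `(t, 0)` is minus the Hessian of `F` transported by
`dτ`.** [cite: Milnor1963, §2] -/
theorem fderiv_fderiv_g (t : ℝ) (v w : ℝ × EuclideanSpace ℝ (Fin 3)) :
    fderiv ℝ (fderiv ℝ D.g) (t, 0) v w =
      -mhessian (𝓡 4) D.F (D.e (circlePt t)) (fderiv ℝ (D.τ t) (t, 0) v) (fderiv ℝ (D.τ t) (t, 0) w) := by
  haveI : IsManifold (𝓡 4) 2 X := IsManifold.of_le (n := ∞) (by norm_cast)
  set x₀ := D.e (circlePt t) with hx₀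
  set φ := extChartAt (𝓡 4) x₀ with hφ
  set Fh : EuclideanSpace ℝ (Fin 4) → ℝ := D.F ∘ φ.symm with hFh
  set G : ℝ × EuclideanSpace ℝ (Fin 3) → ℝ := fun q => D.b - (Fh ∘ D.τ t) q with hG
  -- `g = G` near `(t, 0)`
  have hsrc : ∀ᶠ q : ℝ × EuclideanSpace ℝ (Fin 3) in 𝓝 (t, 0), D.Θ₀ q ∈ φ.source := by
    refine (D.contMDiffAt_Θ₀ t).continuousAt.preimage_mem_nhds ?_
    rw [D.Θ₀_zero]; exact extChartAt_source_mem_nhds x₀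
  have hgG : D.g =ᶠ[𝓝 (t, 0)] G := by
    filter_upwards [D.κ_eventuallyEq t, hsrc] with q hq hqs
    simp only [hG, hFh, g, Θ, τ, comp_apply, hq]
    rw [φ.left_inv hqs]
  rw [hgG.fderiv.fderiv_eq]
  -- `∂∂G = -∂∂(Fh ∘ τ)`
  have hG' : fderiv ℝ G = fun q => -fderiv ℝ (Fh ∘ D.τ t) q := funext fun q => fderiv_const_sub _
  rw [hG', show (fun q => -fderiv ℝ (Fh ∘ D.τ t) q) = -fderiv ℝ (Fh ∘ D.τ t) from rfl, fderiv_neg,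
    FunLike.coe_neg, Pi.neg_apply, FunLike.coe_neg, Pi.neg_apply]
  congr 1
  -- the second-order chain rule at the critical point
  have hmax := IsManifold.chart_mem_maximalAtlas (I := 𝓡 4) (n := 2) x₀
  have hxs := mem_chart_source (EuclideanSpace ℝ (Fin 4)) x₀
  have hF2 : ContMDiffAt (𝓡 4) 𝓘(ℝ, ℝ) 2 D.F x₀ := (D.hF x₀).of_le (by norm_cast)
  have hτ0 : D.τ t (t, 0) = φ x₀ := D.τ_self t
  have hFh2 : ContDiffAt ℝ 2 Fh (D.τ t (t, 0)) := by
    rw [hτ0]; exact contDiffAt_comp_extend_symm hF2 hmax hxs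
  have hτ2 : ContDiffAt ℝ 2 (D.τ t) (t, 0) :=
    (contMDiffAt_iff_contDiffAt.1 (D.contMDiffAt_τ t)).of_le (by norm_cast)
  have hcrit' : fderiv ℝ Fh (D.τ t (t, 0)) = 0 := by
    rw [hτ0]; exact (isMCriticalPt_iff_fderiv_comp_extend_symm_eq_zero hF2 hmax hxs).1 (D.hcrit _)
  rw [fderiv_fderiv_comp_apply_of_fderiv_eq_zero hFh2 hτ2 hcrit', hτ0]
  -- the tree's Hessian in the preferred chart
  rw [← hessianInChart_chartAt, hessianInChart_apply_apply, ModelWithCorners.Boundaryless.range_eq_univ]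
  simp only [fderivWithin_univ]
  rfl

/-- **The fibre Hessian of the height family is positive definite along the zero section.**
[cite: BanyagaHurtubise2004, Thm. 2] [cite: Milnor1963, §2] -/
theorem fibreHessian_pos (t : ℝ) {a : EuclideanSpace ℝ (Fin 3)} (ha : a ≠ 0) :
    0 < fderiv ℝ (fderiv ℝ D.g) (t, 0) ((0 : ℝ), a) ((0 : ℝ), a) := by
  rw [D.fderiv_fderiv_g]
  set w := fderiv ℝ (D.τ t) (t, 0) ((0 : ℝ), a) with hw
  obtain ⟨hle, hnull⟩ := D.hbott (circlePt t) w
  rcases lt_or_eq_of_le hle with hlt | heq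
  · linarith
  · exact absurd (D.eq_zero_of_mem_range (hnull heq)) ha

/-- **The height family of a Morse–Bott maximum circle** (parts A and B): it is `C^∞`,
`1`-periodic in `t`, vanishes and is critical on the zero section, and its fibre Hessians along the
zero section are symmetric and positive definite. [cite: BanyagaHurtubise2004, Thm. 2] -/
theorem heightFamily_spec :
    ContDiff ℝ ∞ D.g ∧ (∀ (t : ℝ) (y : EuclideanSpace ℝ (Fin 3)), D.g (t + 1, y) = D.g (t, y)) ∧
      (∀ t : ℝ, D.g (t, 0) = 0) ∧ (∀ (t : ℝ) (a : EuclideanSpace ℝ (Fin 3)), fderiv ℝ D.g (t, 0) ((0 : ℝ), a) = 0) ∧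
      (∀ (t : ℝ) (a c : EuclideanSpace ℝ (Fin 3)),
        fderiv ℝ (fderiv ℝ D.g) (t, 0) ((0 : ℝ), a) ((0 : ℝ), c) =
          fderiv ℝ (fderiv ℝ D.g) (t, 0) ((0 : ℝ), c) ((0 : ℝ), a)) ∧
      ∀ (t : ℝ) (a : EuclideanSpace ℝ (Fin 3)), a ≠ 0 → 0 < fderiv ℝ (fderiv ℝ D.g) (t, 0) ((0 : ℝ), a) ((0 : ℝ), a) := by
  refine ⟨D.contDiff_g, D.g_add_one, D.g_zero, fun t a => by rw [D.fderiv_g]; rfl, fun t a c => ?_,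
    fun t a ha => D.fibreHessian_pos t ha⟩
  exact (D.contDiff_g.contDiffAt.isSymmSndFDerivAt (by simp only [minSmoothness_of_isRCLikeNormedField]; norm_cast)).eq _ _

end TSetup

end BottTube

end Summit.SmoothPoincare4.SmoothPoincare4.Cruxes.RungOne.Sketch

end
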